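/-
Copyright (c) 2026 the pub-hodgecm-mathlib formalisation cell (harness21).  Prover seat hodgecm-mathlib-F0P3a-p06-g25 (EP-PAIRS hand, RIDER 2b; LEAD F0P3a-plan (g16) T15-11∕T15-20;
G-row reader F0P3a-p09 (g14)); 2026-09-03.
-/
import Summits.HodgeConjecture.HodgeConjecture.Theorems.F0P3cStCharTSEPTraces           -- FILE F (this seat): the EP trace table, the conjugate character
import Summits.HodgeConjecture.HodgeConjecture.Theorems.F0P3cStCharTSP1261bOfCases      -- ★ p852991 (this seat): `isEllipticPairEP_of_table`
import HarnessLib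

/-!
# F0 · P3c · line LH6 «StCharTS» — RIDER 2b «EP-PAIRS», FILE G: THE EP-FAMILY INSTANCE OF PROP. 12.6.1 (b) AT A §12.5 DATUM ON `U(Φ₃)(L⁺_v)`
# `⟨χ_π, χ_{π′}⟩_e ≠ 0`, `π ≠ π′`, `π, π′ ∈ {St_G(ψ), ψ∘det_G}` ⇒ `{π, π′} = {St_G(ψ), ψ∘det_G}` — from the TRACE TABLE of the Euler–Poincaré pseudo-coefficients

Cell `pub/hodgecm-mathlib` (D-0151), FLOOR 0, crux item H413 = `stmt-HodgeConjecture-24833` (`--supports` lane, helper; seat F0P3a-p06 (g25); census «EP-PAIRS» v1 §2–§4).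
THEOREMS ONLY, in the letters of ★ (G3)-EXPLICIT (`K0 K1 I hK0 hK1 hI fG hfG`, and clauses 1∕7∕8 of its conclusion `hfGs h1 h0`), ★ ST-PIN (`ι hιc hι detZ hdetZ`; per-`ψ` clauses
`hdet hne hJH hStL2 hDet` as binder-functions, fields `𝔇.stG 𝔇.detG` — `rfl` at the rung-0 witness), ★ (G5) A (`mQv hμG horb hreg hE hM1 hOpp`) and ★ PCT-OUT (`hPCT`).
HONEST LABEL: count-neutral — this is the `hEP` binder of ★ `F0P3cStCharTSP1261bOfCases.prop1261bNs_of_cases` at the datum (RIDER 2b «EP-PAIRS»); it closes no node by itself;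
HC_CM is proved only modulo the 7 printed citations (hLiu418 = stmt-HodgeConjecture-24832, h413 = stmt-HodgeConjecture-24833) until rung 0 closes.

MATHEMATICS [Rogawski1990 §12.6 Prop. 12.6.1 (b) p. 188].  §1 twisted traces: `Tr St_G(ψ)(f_{St ψ′}) = −Tr (St_G(ψ) ⊗ conj ψ′∘detZ)(f_EP) = −Tr St_G(ψ·conj ψ′)(f_EP) = [ψ = ψ′]`
(★ CLASS-LINEAR, ST-TWIST, FILE F), `Tr St_G(ψ)(f_{det ψ′}) = −[ψ = ψ′]`, `Tr (ψ∘det_G)(f_{det ψ′}) = [ψ = ψ′]`.  §2 the table: by ★ PCT `⟨χ_{π′}, χ_π⟩_e = Tr π′(f_π)` at the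
pseudo-coefficients `f_{St ψ′}`, `f_{det ψ′}` of ★ (G5) A.  §3 the HEAD `isEllipticPairEP_datum` = ★ `isEllipticPairEP_of_table` on §2.

## References
* [Rogawski1990] J. D. Rogawski, *Automorphic Representations of Unitary Groups in Three Variables*, Ann. of Math. Stud. 123 (1990), §12.6 Prop. 12.6.1 (b) p. 188; §12.5 p. 184.
* [Kottwitz1988] R. E. Kottwitz, *Tamagawa numbers*, Ann. of Math. 127 (1988), §2 Theorem 2.
* [BushnellHenniart2006] C. J. Bushnell, G. Henniart, *The Local Langlands Conjecture for GL(2)* (2006), §9.5 (9.5.1) p. 65.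
-/

set_option autoImplicit false
-- the mandated namespace has the single-problem summit's repeated segment (`HodgeConjecture.HodgeConjecture`)
set_option linter.dupNamespace false

noncomputable section

open NumberField IsDedekindDomain MeasureTheory Topology
open scoped Matrix MatrixGroups NNReal WithZero ComplexConjugate
open Literature.NumberTheory.Automorphic Literature.NumberTheory.Automorphic.UnitaryGroup
open Literature.NumberTheory.Rogawski1990 Literature.NumberTheory.Rogawski1990.Ch12Sec5 Literature.NumberTheory.GaloisRepresentations
open Summit.HodgeConjecture.HodgeConjecture.Cruxes.H413.F0P3cStCharTSTorusDefs

namespace Summit.HodgeConjecture.HodgeConjecture.Cruxes.H413.F0P3cStCharTSEPPairs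

open Summit.HodgeConjecture.HodgeConjecture.Cruxes.H413
open Summit.HodgeConjecture.HodgeConjecture.Cruxes.H413.F0P3cStCharTSStTwist
open Summit.HodgeConjecture.HodgeConjecture.Cruxes.H413.F0P3cStCharTSEPTraces
open Summit.HodgeConjecture.HodgeConjecture.Cruxes.H413.F0P3cStCharTSEPPseudoCoeffSt
open Summit.HodgeConjecture.HodgeConjecture.Cruxes.H413.F0P3cStCharTSP1261bOfCases
open Summit.HodgeConjecture.HodgeConjecture.Cruxes.H413.F0P3cStCharTSScTracePackage (isAdmissible_smoothIrrep)

variable (L : Type) [Field L] [NumberField L] [IsCMField L] (v : HeightOneSpectrum (𝓞 ↥(maximalRealSubfield L)))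
  (w : PlacesOver L v) (hw : IsCMField.complexConj L • w.1 = w.1)
  (eA : Gqs L v ≃ₜ* ↥(unitaryGroupOfForm (galAdicCompletionMap (L := L) (IsCMField.complexConj L) hw) ((StdForm.antidiagonal 3).over (w.1.adicCompletion L))))
  (heA : ∀ g : Gqs L v,
    ((eA g : ↥(unitaryGroupOfForm (galAdicCompletionMap (L := L) (IsCMField.complexConj L) hw) ((StdForm.antidiagonal 3).over (w.1.adicCompletion L)))) : GL (Fin 3) (w.1.adicCompletion L)) =
      ((localNonsplitEquiv (IsCMField.complexConj L) (qsForm L) (IsCMField.complexConj_ne_one L) w hw g :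
        ↥(unitaryGroupOfForm (galAdicCompletionMap (L := L) (IsCMField.complexConj L) hw) (placeForm (qsForm L) w.1))) : GL (Fin 3) (w.1.adicCompletion L)))
  (hns : ∀ w' : PlacesOver L v, IsCMField.complexConj L • w'.1 = w'.1) {ϖ : w.1.adicCompletion L}
  (hd : HermitianLattice.UnramifiedLocalConjDatum (galAdicCompletionMap (L := L) (IsCMField.complexConj L) hw) ϖ)
  (g₁ : GL (Fin 3) (w.1.adicCompletion L)) (hg₁ : (g₁ : Matrix (Fin 3) (Fin 3) (w.1.adicCompletion L)) = Matrix.diagonal ![(1 : w.1.adicCompletion L), 1, ϖ])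
  (K0 K1 I : Subgroup (Gqs L v))
  (hK0 : K0 = ((glInt 3 (w.1.adicCompletion L)).subgroupOf
    (unitaryGroupOfForm (galAdicCompletionMap (L := L) (IsCMField.complexConj L) hw) ((StdForm.antidiagonal 3).over (w.1.adicCompletion L)))).comap
      eA.toMulEquiv.toMonoidHom)
  (hK1 : K1 = (((glInt 3 (w.1.adicCompletion L)).map (MulAut.conj g₁).toMonoidHom).subgroupOf
    (unitaryGroupOfForm (galAdicCompletionMap (L := L) (IsCMField.complexConj L) hw) ((StdForm.antidiagonal 3).over (w.1.adicCompletion L)))).comap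
      eA.toMulEquiv.toMonoidHom)
  (hI : I = K0 ⊓ K1)
  [MeasurableSpace (Gqs L v)] [BorelSpace (Gqs L v)] (νQv : Measure (Gqs L v)) [νQv.IsHaarMeasure]
  (fG : Gqs L v → ℂ)
  (hfG : fG = fun g => (((νQv K0).toReal : ℂ))⁻¹ * (K0 : Set (Gqs L v)).indicator (fun _ => (1 : ℂ)) g +
    (((νQv K1).toReal : ℂ))⁻¹ * (K1 : Set (Gqs L v)).indicator (fun _ => (1 : ℂ)) g -
    (((νQv I).toReal : ℂ))⁻¹ * (I : Set (Gqs L v)).indicator (fun _ => (1 : ℂ)) g)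
  (ι : ↥(normOneUnits (conjLocal L (IsCMField.complexConj L) v)) →* ↥(Subgroup.center (Gqs L v))) (hιc : Continuous ι)
  (hι : ∀ z : ↥(normOneUnits (conjLocal L (IsCMField.complexConj L) v)),
    ((ι z).val.val.val : Matrix (Fin 3) (Fin 3) (LocalRing L v)) = (((z : (LocalRing L v)ˣ) : LocalRing L v)) • (1 : Matrix (Fin 3) (Fin 3) (LocalRing L v)))
  (detZ : Gqs L v →* ↥(Subgroup.center (Gqs L v)))
  (hdetZ : ∀ g : Gqs L v, ((detZ g).val.val.val : Matrix (Fin 3) (Fin 3) (LocalRing L v)) =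
      (g.val.val : Matrix (Fin 3) (Fin 3) (LocalRing L v)).det • (1 : Matrix (Fin 3) (Fin 3) (LocalRing L v)))
  [MeasurableSpace (Gqs L v ⧸ Subgroup.center (Gqs L v))] (μZ : Measure (Gqs L v ⧸ Subgroup.center (Gqs L v)))

/-! ## §1 Twisted traces: `Tr St_G(ψ)(f_{St ψ′}) = [ψ = ψ′]`, `Tr St_G(ψ)(f_{det ψ′}) = −[ψ = ψ′]`, `Tr (ψ∘det_G)(f_{det ψ′}) = [ψ = ψ′]` (letters `stG detG`) -/

section Letters

variable (stG detG : (↥(Subgroup.center (Gqs L v)) →* ℂˣ) → IrrClass (Gqs L v))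
  (hdet : ∀ ψ : ↥(Subgroup.center (Gqs L v)) →* ℂˣ, Continuous ψ →
    ∃ hopen : IsOpen (((ψ.comp detZ).ker : Subgroup (Gqs L v)) : Set (Gqs L v)), detG ψ = IrrClass.mk (SmoothIrrep.ofChar (ψ.comp detZ) hopen))
  (hne : ∀ ψ : ↥(Subgroup.center (Gqs L v)) →* ℂˣ, Continuous ψ → stG ψ ≠ detG ψ)
  (hJH : ∀ ψ : ↥(Subgroup.center (Gqs L v)) →* ℂˣ, Continuous ψ → ∀ c : IrrClass (Gqs L v),
    c.IsConstituentOf (cmPrincipalSeries L 3 v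
      (cmTorusCharPair L v (halfModulusChar (LocalRing L v) * halfModulusChar (LocalRing L v))⁻¹ (ψ.comp ι))) ↔ (c = stG ψ ∨ c = detG ψ))
  (hStL2 : ∀ ψ : ↥(Subgroup.center (Gqs L v)) →* ℂˣ, Continuous ψ → (stG ψ).IsSquareIntegrable μZ)
  (hDet : ∀ ψ : ↥(Subgroup.center (Gqs L v)) →* ℂˣ, Continuous ψ → ¬ (detG ψ).IsSquareIntegrable μZ)

include heA hns hd hg₁ hK0 hK1 hI hfG hιc hι hdetZ hdet hne hJH hStL2 hDet in
open Classical in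
set_option maxHeartbeats 1600000 in
set_option synthInstance.maxHeartbeats 400000 in
-- instance-path unification between `Gqs L v` and the literal carrier of ★ `cmPrincipalSeries`
/-- **`Tr St_G(ψ)(f_{St ψ′}) = [ψ = ψ′]`**, `f_{St ψ′} = −conj(ψ′∘detZ)·f_EP` (★ CLASS-LINEAR `smoothTrace_mk_neg_conj_character_mul_eq`; ST-TWIST `stG_twist_eq` at the unitary
`conj ψ′`; FILE F `smoothTrace_stG_ep` at `ψ·conj ψ′` and `mul_conjChar_eq_one_iff`). [cite: Rogawski1990, §12.6 Prop. 12.6.1 (b) p. 188] [cite: BushnellHenniart2006, §9.5 (9.5.1) p. 65] -/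
theorem smoothTrace_stG_epSt (ψ ψ' : ↥(Subgroup.center (Gqs L v)) →* ℂˣ) (hψ : Continuous ψ) (hψ' : Continuous ψ') :
    (stG ψ).smoothTrace νQv (fun g => -(conj (((ψ' (detZ g)) : ℂˣ) : ℂ) * fG g)) = if ψ = ψ' then 1 else 0 := by
  haveI : NonarchimedeanGroup (Gqs L v) := nonarchimedeanGroup_cmLocal L 3 v
  haveI : LocallyCompactSpace (Gqs L v) := locallyCompactSpace_cmDatum_local (L := L) (N := 3) (H := qsForm L) (v := v)
  obtain ⟨r, hr⟩ := IrrClass.mk_surjective (stG ψ)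
  obtain ⟨hopen', -⟩ := hdet ψ' hψ'
  have hμc : Continuous ⇑((Units.map ((starRingEnd ℂ : ℂ →+* ℂ) : ℂ →* ℂ)).comp ψ') := continuous_conjChar ψ' hψ'
  have hψμ : Continuous ⇑(ψ * (Units.map ((starRingEnd ℂ : ℂ →+* ℂ) : ℂ →* ℂ)).comp ψ') := by
    show Continuous fun z => ψ z * ((Units.map ((starRingEnd ℂ : ℂ →+* ℂ) : ℂ →* ℂ)).comp ψ') z
    exact hψ.mul hμc
  have hcl : (IrrClass.mk r).smoothTrace νQv (fun g => -(conj (((ψ' (detZ g)) : ℂˣ) : ℂ) * fG g)) =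
      -((IrrClass.twist (((Units.map ((starRingEnd ℂ : ℂ →+* ℂ) : ℂ →* ℂ)).comp ψ').comp detZ) (isOpen_ker_conjChar_comp L v detZ ψ' hopen')
        (IrrClass.mk r)).smoothTrace νQv fG) :=
    IrrClass.smoothTrace_mk_neg_conj_character_mul_eq νQv (ψ'.comp detZ) hopen' r (isAdmissible_smoothIrrep L v hns r) fG
  have htw := stG_twist_eq L v μZ ι hι detZ hdetZ stG detG hJH hStL2 hDet ψ ((Units.map ((starRingEnd ℂ : ℂ →+* ℂ) : ℂ →* ℂ)).comp ψ') hψ hμc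
    (norm_conjChar_eq_one L v hns ψ' hψ') (isOpen_ker_conjChar_comp L v detZ ψ' hopen')
  obtain ⟨hopen'', hdet''⟩ := hdet _ hψμ
  rw [← hr, hcl, hr, htw, smoothTrace_stG_ep L v w hw eA heA hns hd g₁ hg₁ K0 K1 I hK0 hK1 hI νQv fG hfG ι hιc hι detZ hdetZ stG detG _ hψμ hopen'' hdet''
    (hne _ hψμ) (hJH _ hψμ), neg_neg]
  by_cases h : ψ = ψ'
  · rw [if_pos ((mul_conjChar_eq_one_iff L v hns ψ ψ' hψ').2 h), if_pos h]
  · rw [if_neg (fun h1 => h ((mul_conjChar_eq_one_iff L v hns ψ ψ' hψ').1 h1)), if_neg h]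

include heA hns hd hg₁ hK0 hK1 hI hfG hιc hι hdetZ hdet hne hJH hStL2 hDet in
open Classical in
set_option maxHeartbeats 1600000 in
set_option synthInstance.maxHeartbeats 400000 in
-- instance-path unification between `Gqs L v` and the literal carrier of ★ `cmPrincipalSeries`
/-- **`Tr St_G(ψ)(f_{det ψ′}) = −[ψ = ψ′]`**, `f_{det ψ′} = conj(ψ′∘detZ)·f_EP` (★ CLASS-LINEAR `smoothTrace_mk_conj_character_mul_eq`; ST-TWIST; FILE F).
[cite: Rogawski1990, §12.6 Prop. 12.6.1 (b) p. 188] [cite: BushnellHenniart2006, §9.5 (9.5.1) p. 65] -/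
theorem smoothTrace_stG_epDet (ψ ψ' : ↥(Subgroup.center (Gqs L v)) →* ℂˣ) (hψ : Continuous ψ) (hψ' : Continuous ψ') :
    (stG ψ).smoothTrace νQv (fun g => conj (((ψ' (detZ g)) : ℂˣ) : ℂ) * fG g) = -(if ψ = ψ' then 1 else 0) := by
  haveI : NonarchimedeanGroup (Gqs L v) := nonarchimedeanGroup_cmLocal L 3 v
  haveI : LocallyCompactSpace (Gqs L v) := locallyCompactSpace_cmDatum_local (L := L) (N := 3) (H := qsForm L) (v := v)
  obtain ⟨r, hr⟩ := IrrClass.mk_surjective (stG ψ)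
  obtain ⟨hopen', -⟩ := hdet ψ' hψ'
  have hμc : Continuous ⇑((Units.map ((starRingEnd ℂ : ℂ →+* ℂ) : ℂ →* ℂ)).comp ψ') := continuous_conjChar ψ' hψ'
  have hψμ : Continuous ⇑(ψ * (Units.map ((starRingEnd ℂ : ℂ →+* ℂ) : ℂ →* ℂ)).comp ψ') := by
    show Continuous fun z => ψ z * ((Units.map ((starRingEnd ℂ : ℂ →+* ℂ) : ℂ →* ℂ)).comp ψ') z
    exact hψ.mul hμc
  have hcl : (IrrClass.mk r).smoothTrace νQv (fun g => conj (((ψ' (detZ g)) : ℂˣ) : ℂ) * fG g) =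
      (IrrClass.twist (((Units.map ((starRingEnd ℂ : ℂ →+* ℂ) : ℂ →* ℂ)).comp ψ').comp detZ) (isOpen_ker_conjChar_comp L v detZ ψ' hopen')
        (IrrClass.mk r)).smoothTrace νQv fG :=
    IrrClass.smoothTrace_mk_conj_character_mul_eq νQv (ψ'.comp detZ) hopen' r (isAdmissible_smoothIrrep L v hns r) fG
  have htw := stG_twist_eq L v μZ ι hι detZ hdetZ stG detG hJH hStL2 hDet ψ ((Units.map ((starRingEnd ℂ : ℂ →+* ℂ) : ℂ →* ℂ)).comp ψ') hψ hμc
    (norm_conjChar_eq_one L v hns ψ' hψ') (isOpen_ker_conjChar_comp L v detZ ψ' hopen')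
  obtain ⟨hopen'', hdet''⟩ := hdet _ hψμ
  rw [← hr, hcl, hr, htw, smoothTrace_stG_ep L v w hw eA heA hns hd g₁ hg₁ K0 K1 I hK0 hK1 hI νQv fG hfG ι hιc hι detZ hdetZ stG detG _ hψμ hopen'' hdet''
    (hne _ hψμ) (hJH _ hψμ)]
  by_cases h : ψ = ψ'
  · rw [if_pos ((mul_conjChar_eq_one_iff L v hns ψ ψ' hψ').2 h), if_pos h]
  · rw [if_neg (fun h1 => h ((mul_conjChar_eq_one_iff L v hns ψ ψ' hψ').1 h1)), if_neg h]

omit [MeasurableSpace (Gqs L v ⧸ Subgroup.center (Gqs L v))] in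
include heA hns hd hg₁ hK0 hK1 hI hfG hι hdetZ hdet in
open Classical in
/-- **`Tr (ψ∘det_G)(f_{det ψ′}) = [ψ = ψ′]`** (★ CLASS-LINEAR at the representative `𝟙 ⊗ ψ∘detZ`; ST-TWIST `detG_twist_eq`; FILE F `smoothTrace_detG_ep` at `ψ·conj ψ′`).
[cite: Rogawski1990, §12.6 Prop. 12.6.1 (b) p. 188] [cite: BushnellHenniart2006, §9.5 (9.5.1) p. 65] -/
theorem smoothTrace_detG_epDet (ψ ψ' : ↥(Subgroup.center (Gqs L v)) →* ℂˣ) (hψ : Continuous ψ) (hψ' : Continuous ψ') :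
    (detG ψ).smoothTrace νQv (fun g => conj (((ψ' (detZ g)) : ℂˣ) : ℂ) * fG g) = if ψ = ψ' then 1 else 0 := by
  haveI : NonarchimedeanGroup (Gqs L v) := nonarchimedeanGroup_cmLocal L 3 v
  haveI : LocallyCompactSpace (Gqs L v) := locallyCompactSpace_cmDatum_local (L := L) (N := 3) (H := qsForm L) (v := v)
  obtain ⟨hopenψ, hdetψ⟩ := hdet ψ hψ
  obtain ⟨hopen', -⟩ := hdet ψ' hψ'
  have hμc : Continuous ⇑((Units.map ((starRingEnd ℂ : ℂ →+* ℂ) : ℂ →* ℂ)).comp ψ') := continuous_conjChar ψ' hψ'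
  have hψμ : Continuous ⇑(ψ * (Units.map ((starRingEnd ℂ : ℂ →+* ℂ) : ℂ →* ℂ)).comp ψ') := by
    show Continuous fun z => ψ z * ((Units.map ((starRingEnd ℂ : ℂ →+* ℂ) : ℂ →* ℂ)).comp ψ') z
    exact hψ.mul hμc
  obtain ⟨hopen'', hdet''⟩ := hdet _ hψμ
  have hcl : (IrrClass.mk (SmoothIrrep.ofChar (ψ.comp detZ) hopenψ)).smoothTrace νQv (fun g => conj (((ψ' (detZ g)) : ℂˣ) : ℂ) * fG g) =
      (IrrClass.twist (((Units.map ((starRingEnd ℂ : ℂ →+* ℂ) : ℂ →* ℂ)).comp ψ').comp detZ) (isOpen_ker_conjChar_comp L v detZ ψ' hopen')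
        (IrrClass.mk (SmoothIrrep.ofChar (ψ.comp detZ) hopenψ))).smoothTrace νQv fG :=
    IrrClass.smoothTrace_mk_conj_character_mul_eq νQv (ψ'.comp detZ) hopen' _ (isAdmissible_smoothIrrep L v hns _) fG
  have htw := detG_twist_eq L v detZ detG ψ ((Units.map ((starRingEnd ℂ : ℂ →+* ℂ) : ℂ →* ℂ)).comp ψ') hopenψ
    (isOpen_ker_conjChar_comp L v detZ ψ' hopen') hopen'' hdetψ hdet''
  rw [hdetψ, hcl, ← hdetψ, htw, smoothTrace_detG_ep L v w hw eA heA hns hd g₁ hg₁ K0 K1 I hK0 hK1 hI νQv fG hfG ι hι detZ hdetZ detG _ hopen'' hdet'']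
  by_cases h : ψ = ψ'
  · rw [if_pos ((mul_conjChar_eq_one_iff L v hns ψ ψ' hψ').2 h), if_pos h]
  · rw [if_neg (fun h1 => h ((mul_conjChar_eq_one_iff L v hns ψ ψ' hψ').1 h1)), if_neg h]

end Letters

/-! ## §2 The trace table of `⟨·,·⟩_e` on the EP family at a §12.5 datum (★ PCT at the EP pseudo-coefficients of ★ (G5) A) -/

section Datum

variable [∀ γ : Gqs L v, MeasurableSpace (Gqs L v ⧸ Subgroup.centralizer ({γ} : Set (Gqs L v)))]
  {H : Type} [Group H] [TopologicalSpace H] [IsTopologicalGroup H] [MeasurableSpace H]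
  (mQv : OrbitalMeasureFamily (Gqs L v)) (𝔇 : EllipticData (Gqs L v) H)
  (hμG : 𝔇.μG = νQv) (horb : 𝔇.orb = mQv)
  (hreg : ∀ γ : Gqs L v, γ ∈ 𝔇.regG ↔ IsRegularElt (γ.val : GL (Fin 3) (UnitaryGroup.LocalRing L v)))
  (hE : ∀ γ : Gqs L v, γ ∈ 𝔇.ellG ↔ IsRegularElt (γ.val : GL (Fin 3) (UnitaryGroup.LocalRing L v)) ∧ γ ∉ hyperbolicSet L v)
  (hM1 : ∀ π : IrrClass (Gqs L v), Measurable (𝔇.char π) ∧ LocallyIntegrable (𝔇.char π) 𝔇.μG ∧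
    (∀ x ∈ 𝔇.regG, ∀ᶠ y in 𝓝 x, 𝔇.char π y = 𝔇.char π x) ∧
    ∀ φ : Gqs L v → ℂ, IsLocSmooth φ → π.smoothTrace 𝔇.μG φ = ∫ x, φ x * 𝔇.char π x ∂𝔇.μG)
  (hPCT : Ch12Sec6.PseudoCoeffTrace 𝔇)
  (hfGs : IsLocSmooth fG)
  (h1 : ∀ γ : Gqs L v, IsRegularElt (γ.val : GL (Fin 3) (UnitaryGroup.LocalRing L v)) →
    IsCompact ((Subgroup.centralizer ({γ} : Set (Gqs L v))) : Set (Gqs L v)) → classOrbitalIntegral mQv fG (ConjClasses.mk γ) = 1)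
  (h0 : ∀ γ : Gqs L v, IsRegularElt (γ.val : GL (Fin 3) (UnitaryGroup.LocalRing L v)) →
    ¬ IsCompact ((Subgroup.centralizer ({γ} : Set (Gqs L v))) : Set (Gqs L v)) → classOrbitalIntegral mQv fG (ConjClasses.mk γ) = 0)
  (hdet : ∀ ψ : ↥(Subgroup.center (Gqs L v)) →* ℂˣ, Continuous ψ →
    ∃ hopen : IsOpen (((ψ.comp detZ).ker : Subgroup (Gqs L v)) : Set (Gqs L v)), 𝔇.detG ψ = IrrClass.mk (SmoothIrrep.ofChar (ψ.comp detZ) hopen))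
  (hne : ∀ ψ : ↥(Subgroup.center (Gqs L v)) →* ℂˣ, Continuous ψ → 𝔇.stG ψ ≠ 𝔇.detG ψ)
  (hJH : ∀ ψ : ↥(Subgroup.center (Gqs L v)) →* ℂˣ, Continuous ψ → ∀ c : IrrClass (Gqs L v),
    c.IsConstituentOf (cmPrincipalSeries L 3 v
      (cmTorusCharPair L v (halfModulusChar (LocalRing L v) * halfModulusChar (LocalRing L v))⁻¹ (ψ.comp ι))) ↔ (c = 𝔇.stG ψ ∨ c = 𝔇.detG ψ))
  (hStL2 : ∀ ψ : ↥(Subgroup.center (Gqs L v)) →* ℂˣ, Continuous ψ → (𝔇.stG ψ).IsSquareIntegrable μZ)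
  (hDet : ∀ ψ : ↥(Subgroup.center (Gqs L v)) →* ℂˣ, Continuous ψ → ¬ (𝔇.detG ψ).IsSquareIntegrable μZ)
  (hOpp : ∀ ψ : ↥(Subgroup.center (Gqs L v)) →* ℂˣ, Continuous ψ → ∀ γ ∈ 𝔇.ellG, 𝔇.char (𝔇.stG ψ) γ = -𝔇.char (𝔇.detG ψ) γ)

include heA hns hd hg₁ hK0 hK1 hI hfG hιc hι hdetZ hμG horb hreg hE hM1 hPCT hfGs h1 h0 hdet hne hJH hStL2 hDet hOpp in
open Classical in
set_option maxHeartbeats 1600000 in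
set_option synthInstance.maxHeartbeats 400000 in
-- instance-path unification between `Gqs L v` and the literal carrier of ★ `cmPrincipalSeries`
/-- **TABLE ROW 1: `⟨χ_{St_G(ψ)}, χ_{St_G(ψ′)}⟩_e = [ψ = ψ′]`** (★ PCT at the pseudo-coefficient `f_{St ψ′}` of ★ (G5) A `isPseudoCoeff_stG_of_ep`; §1 `smoothTrace_stG_epSt`).
[cite: Rogawski1990, §12.6 Prop. 12.6.1 (b) p. 188; §12.5 p. 184] [cite: Kottwitz1988, §2 Theorem 2] -/
theorem innerG_char_stG_stG (ψ ψ' : ↥(Subgroup.center (Gqs L v)) →* ℂˣ) (hψ : Continuous ψ) (hψ' : Continuous ψ') :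
    𝔇.innerG (𝔇.char (𝔇.stG ψ)) (𝔇.char (𝔇.stG ψ')) = if ψ = ψ' then 1 else 0 := by
  obtain ⟨hopen', hdet'⟩ := hdet ψ' hψ'
  have hpc := isPseudoCoeff_stG_of_ep L v hns νQv mQv 𝔇 hμG horb hreg hE hM1 detZ hopen' hdet' (hOpp ψ' hψ') hfGs h1 h0
  rw [← hPCT (𝔇.stG ψ') (𝔇.stG ψ) _ hpc, hμG]
  exact smoothTrace_stG_epSt L v w hw eA heA hns hd g₁ hg₁ K0 K1 I hK0 hK1 hI νQv fG hfG ι hιc hι detZ hdetZ μZ 𝔇.stG 𝔇.detG hdet hne hJH hStL2 hDet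
    ψ ψ' hψ hψ'

include heA hns hd hg₁ hK0 hK1 hI hfG hιc hι hdetZ hμG horb hreg hE hM1 hPCT hfGs h1 h0 hdet hne hJH hStL2 hDet in
open Classical in
set_option maxHeartbeats 1600000 in
set_option synthInstance.maxHeartbeats 400000 in
-- instance-path unification between `Gqs L v` and the literal carrier of ★ `cmPrincipalSeries`
/-- **TABLE ROW 2: `⟨χ_{St_G(ψ)}, χ_{ψ′∘det_G}⟩_e = −[ψ = ψ′]`** (★ PCT at the pseudo-coefficient `f_{det ψ′}` of ★ (G5) A `isPseudoCoeff_detG_of_ep`; §1 `smoothTrace_stG_epDet`).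
[cite: Rogawski1990, §12.6 Prop. 12.6.1 (b) p. 188; §12.5 p. 184] [cite: Kottwitz1988, §2 Theorem 2] -/
theorem innerG_char_stG_detG (ψ ψ' : ↥(Subgroup.center (Gqs L v)) →* ℂˣ) (hψ : Continuous ψ) (hψ' : Continuous ψ') :
    𝔇.innerG (𝔇.char (𝔇.stG ψ)) (𝔇.char (𝔇.detG ψ')) = -(if ψ = ψ' then 1 else 0) := by
  obtain ⟨hopen', hdet'⟩ := hdet ψ' hψ'
  have hpc := isPseudoCoeff_detG_of_ep L v hns νQv mQv 𝔇 hμG horb hreg hE hM1 detZ hopen' hdet' hfGs h1 h0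
  rw [← hPCT (𝔇.detG ψ') (𝔇.stG ψ) _ hpc, hμG]
  exact smoothTrace_stG_epDet L v w hw eA heA hns hd g₁ hg₁ K0 K1 I hK0 hK1 hI νQv fG hfG ι hιc hι detZ hdetZ μZ 𝔇.stG 𝔇.detG hdet hne hJH hStL2 hDet
    ψ ψ' hψ hψ'

include heA hns hd hg₁ hK0 hK1 hI hfG hι hdetZ hμG horb hreg hE hM1 hPCT hfGs h1 h0 hdet in
open Classical in
/-- **TABLE ROW 3: `⟨χ_{ψ∘det_G}, χ_{ψ′∘det_G}⟩_e = [ψ = ψ′]`** (★ PCT at `f_{det ψ′}`; §1 `smoothTrace_detG_epDet`).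
[cite: Rogawski1990, §12.6 Prop. 12.6.1 (b) p. 188; §12.5 p. 184] [cite: Kottwitz1988, §2 Theorem 2] -/
theorem innerG_char_detG_detG (ψ ψ' : ↥(Subgroup.center (Gqs L v)) →* ℂˣ) (hψ : Continuous ψ) (hψ' : Continuous ψ') :
    𝔇.innerG (𝔇.char (𝔇.detG ψ)) (𝔇.char (𝔇.detG ψ')) = if ψ = ψ' then 1 else 0 := by
  obtain ⟨hopen', hdet'⟩ := hdet ψ' hψ'
  have hpc := isPseudoCoeff_detG_of_ep L v hns νQv mQv 𝔇 hμG horb hreg hE hM1 detZ hopen' hdet' hfGs h1 h0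
  rw [← hPCT (𝔇.detG ψ') (𝔇.detG ψ) _ hpc, hμG]
  exact smoothTrace_detG_epDet L v w hw eA heA hns hd g₁ hg₁ K0 K1 I hK0 hK1 hI νQv fG hfG ι hι detZ hdetZ 𝔇.detG hdet ψ ψ' hψ hψ'

/-! ## §3 HEAD: the EP-family instance of Prop. 12.6.1 (b) at the datum — the `hEP` binder of ★ `prop1261bNs_of_cases` -/

include heA hns hd hg₁ hK0 hK1 hI hfG hιc hι hdetZ hμG horb hreg hE hM1 hPCT hfGs h1 h0 hdet hne hJH hStL2 hDet hOpp in
set_option maxHeartbeats 1600000 in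
set_option synthInstance.maxHeartbeats 400000 in
-- instance-path unification between `Gqs L v` and the literal carrier of ★ `cmPrincipalSeries`
/-- **RIDER 2b «EP-PAIRS» — THE EP-FAMILY INSTANCE OF PROP. 12.6.1 (b) AT A §12.5 DATUM ON `U(Φ₃)(L⁺_v)`.**  If `π, π′ ∈ {St_G(ψ), ψ∘det_G : ψ continuous}`,
`⟨χ_π, χ_{π′}⟩_e ≠ 0` and `π ≠ π′`, then `{π, π′} = {St_G(ψ), ψ∘det_G}` for one `ψ` (`𝔇.IsEllipticPair π π′`): ★ `isEllipticPairEP_of_table` on the three rows of §2 — the `hEP`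
binder of ★ `F0P3cStCharTSP1261bOfCases.prop1261bNs_of_cases 𝔇 hEP hRest`, TOKEN FOR TOKEN, in the letters of ★ (G3)-EXPLICIT, ★ ST-PIN, ★ (G5) A and ★ PCT-OUT.
[cite: Rogawski1990, §12.6 Prop. 12.6.1 (b) p. 188] [cite: Kottwitz1988, §2 Theorem 2] -/
theorem isEllipticPairEP_datum :
    ∀ π π' : IrrClass (Gqs L v),
      (∃ ψ : ↥(Subgroup.center (Gqs L v)) →* ℂˣ, Continuous ψ ∧ (π = 𝔇.stG ψ ∨ π = 𝔇.detG ψ)) →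
      (∃ ψ' : ↥(Subgroup.center (Gqs L v)) →* ℂˣ, Continuous ψ' ∧ (π' = 𝔇.stG ψ' ∨ π' = 𝔇.detG ψ')) →
      𝔇.innerG (𝔇.char π) (𝔇.char π') ≠ 0 → π ≠ π' → 𝔇.IsEllipticPair π π' := by
  classical
  refine isEllipticPairEP_of_table 𝔇 (fun ψ ψ' hψ hψ' hneq => ?_) (fun ψ ψ' hψ hψ' hne0 => ?_) (fun ψ ψ' hψ hψ' hneq => ?_)
  · rw [innerG_char_stG_stG L v w hw eA heA hns hd g₁ hg₁ K0 K1 I hK0 hK1 hI νQv fG hfG ι hιc hι detZ hdetZ μZ mQv 𝔇 hμG horb hreg hE hM1 hPCT hfGs h1 h0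
      hdet hne hJH hStL2 hDet hOpp ψ ψ' hψ hψ', if_neg]
    rintro rfl
    exact hneq rfl
  · by_contra h
    rw [innerG_char_stG_detG L v w hw eA heA hns hd g₁ hg₁ K0 K1 I hK0 hK1 hI νQv fG hfG ι hιc hι detZ hdetZ μZ mQv 𝔇 hμG horb hreg hE hM1 hPCT hfGs h1 h0
      hdet hne hJH hStL2 hDet ψ ψ' hψ hψ', if_neg h, neg_zero] at hne0
    exact hne0 rfl
  · rw [innerG_char_detG_detG L v w hw eA heA hns hd g₁ hg₁ K0 K1 I hK0 hK1 hI νQv fG hfG ι hι detZ hdetZ mQv 𝔇 hμG horb hreg hE hM1 hPCT hfGs h1 h0 hdet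
      ψ ψ' hψ hψ', if_neg]
    rintro rfl
    exact hneq rfl

end Datum

end Summit.HodgeConjecture.HodgeConjecture.Cruxes.H413.F0P3cStCharTSEPPairs

end
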